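import Summits.CriticalPhenomena.PercolationContinuityZ3.Theorems.Transplant.FKConnectivityAllQAntipodalWiredUpc
import Summits.CriticalPhenomena.PercolationContinuityZ3.Theorems.Transplant.FKConnectivityAllQAntipodalX2DualPos
import Summits.CriticalPhenomena.PercolationContinuityZ3.Theorems.Transplant.FKConnectivityAllQAntipodalSplitClosure
import HarnessLib

/-!
# Connectivity correlation inequalities for `φ_{w,q}` — **the PARALLEL TWIN: `U¹¹(y ∥ M) ≥ 0`** (`0 < q ≤ 1`) — the split up-correlation
# functional of a two-terminal series–parallel network with the first marked edge directly across the terminals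

Theorem file (`--supports stmt-CriticalPhenomena-4575`), FK sub-lane `prim-bschramm-fk-2` (gen 14); builds on p205010 (kernel theorem,
internal audit signed; external expert review pending).  No definitions, no named facts, no sorries; standard axioms.

THE IDENTITY (`FK.apUpcSplit_parallel_twin_eq`, memo g14 §5.6 — the series–parallel DUAL of gen 12's `q·V = q·U + (1-q)·X2`):
for `M ∋ z = uv`, `y = st ∉ M`, `T = M ∖ z` and `h` not reading `y, z` (sections `g`),
`q · apUpcSplit q (M ∪ {y}) s t y z h = q² · apUpcW q T s t u v g + (1 - q) · apX2Dual q T s t u v g`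
— configuration by configuration, after flipping the complement half of `apX2Dual`, the pointwise identity
`q^{δ+c}(1-c̄^z) - q^{δ̄+c̄}(1-c^z) = q²(c^z - c̄^z) + (1-q)[(q c^z + 1 - c^z)(1 - c̄^z) a - (q c̄^z + 1 - c̄^z)(1 - c^z) ā]` over the five realizable
patterns of `(c, δ, c^z, a) = (1{s↔t in C}, 1{u↮v in C}, 1{s↔t in C∪z}, 1{u↔v in C∪st})` (`FK.twin_side_cases`, from the single pivotal-edge lemma).
THE THEOREM (`FK.apUpcSplit_parallel_twin_nonneg`): for `M` two-terminal series–parallel between `s, t`, `uv ∈ M`, `st ∉ M`, `0 < q ≤ 1` and `h`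
monotone on the sub-configurations of `M ∪ {st}` not reading the marked edges: `0 ≤ apUpcSplit q (insert st M) s t st uv h` — by the identity,
Theorem U for `M/z` (`FK.apUpcW_nonneg_of_isTTSP`) and `X2∨ ≥ 0` (`FK.apX2Dual_nonneg_of_isTTSP`).  With gen 14's pendant core (`…X2Pos`) and the
composition closure (`…SplitClosure`) this settles Conjecture U¹¹ of memo g11 whenever the split node of the two marked edges has a
single-edge child.
[cite: Grimmett2006, §1.4 eq. (1.20) (p. 15); §3.8 (pp. 61–62); §3.9 (p. 63); §6.1 (pp. 133–136)]
-/

noncomputable section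

namespace Summit.CriticalPhenomena.PercolationContinuityZ3.Theorems

namespace FK

open SimpleGraph Literature.Probability.LatticeModels Literature.Probability.Percolation X2Word
open scoped Classical

variable {V : Type*}

/-! ### One pivotal edge -/

/-- Open graph of a configuration with one more edge. [folklore] -/
theorem openGraph_insert (X : Finset (Sym2 V)) (x y : V) :
    openGraph (↑(insert s(x, y) X) : BondConfig V) = openGraph (↑X : BondConfig V) ⊔ edge x y := by
  have : (↑(insert s(x, y) X) : BondConfig V) = ↑X ∪ {s(x, y)} := by rw [Finset.coe_insert, Set.insert_eq, Set.union_comm]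
  rw [this, openGraph, openGraph, fromEdgeSet_union]; rfl

/-- **Single pivotal edge**: a connection through `X ∪ {xy}` is a connection through `X`, or runs through the edge one way or the other. [folklore] -/
theorem reach_insert_edge {X : Finset (Sym2 V)} {x y p p' : V} (h : (openGraph (↑(insert s(x, y) X) : BondConfig V)).Reachable p p') :
    (openGraph (↑X : BondConfig V)).Reachable p p' ∨
      ((openGraph (↑X : BondConfig V)).Reachable p x ∧ (openGraph (↑X : BondConfig V)).Reachable y p') ∨
      ((openGraph (↑X : BondConfig V)).Reachable p y ∧ (openGraph (↑X : BondConfig V)).Reachable x p') := by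
  rw [openGraph_insert] at h
  exact reachable_sup_edge_imp _ x y h

/-- Monotonicity under inserting an edge. [folklore] -/
theorem reach_mono_insert {X : Finset (Sym2 V)} (e : Sym2 V) {p p' : V} (h : (openGraph (↑X : BondConfig V)).Reachable p p') :
    (openGraph (↑(insert e X) : BondConfig V)).Reachable p p' :=
  h.mono (openGraph_mono (Finset.coe_subset.2 (Finset.subset_insert _ _)))

/-- The inserted edge itself. [folklore] -/
theorem reach_insert_self (X : Finset (Sym2 V)) {x y : V} (hxy : x ≠ y) :
    (openGraph (↑(insert s(x, y) X) : BondConfig V)).Reachable x y :=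
  Adj.reachable ((openGraph_adj _ x y).2 ⟨by rw [Finset.coe_insert]; exact Set.mem_insert _ _, hxy⟩)

section Identity

variable [Fintype V]

/-- **The five realizable patterns of one side**: with `c = 1{s↔t in X}`, `d = 1{u↮v in X}`, `c^z = 1{s↔t in X∪uv}`, `a = 1{u↔v in X∪st}`
(as real numbers), `(c, d, c^z, a) ∈ {(1,0,1,1), (1,1,1,0), (0,1,1,1), (0,0,0,1), (0,1,0,0)}`. [folklore] -/
theorem twin_side_cases (X : Finset (Sym2 V)) {s t u v : V} (hst : s ≠ t) (huv : u ≠ v) :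
    let c : ℝ := apConn X s t
    let d : ℕ := if (openGraph (↑X : BondConfig V)).Reachable u v then 0 else 1
    let cz : ℝ := apConn (insert s(u, v) X) s t
    let a : ℝ := apConn (insert s(s, t) X) u v
    (c = 1 ∧ d = 0 ∧ cz = 1 ∧ a = 1) ∨ (c = 1 ∧ d = 1 ∧ cz = 1 ∧ a = 0) ∨ (c = 0 ∧ d = 1 ∧ cz = 1 ∧ a = 1) ∨
      (c = 0 ∧ d = 0 ∧ cz = 0 ∧ a = 1) ∨ (c = 0 ∧ d = 1 ∧ cz = 0 ∧ a = 0) := by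
  intro c d cz a
  by_cases hc : (openGraph (↑X : BondConfig V)).Reachable s t
  · have hcz : (openGraph (↑(insert s(u, v) X) : BondConfig V)).Reachable s t := reach_mono_insert _ hc
    by_cases hd : (openGraph (↑X : BondConfig V)).Reachable u v
    · refine Or.inl ⟨apConn_of_reachable hc, if_pos hd, apConn_of_reachable hcz, apConn_of_reachable (reach_mono_insert _ hd)⟩
    · refine Or.inr (Or.inl ⟨apConn_of_reachable hc, if_neg hd, apConn_of_reachable hcz, apConn_of_not_reachable fun ha => hd ?_⟩)
      rcases reach_insert_edge ha with h | ⟨h1, h2⟩ | ⟨h1, h2⟩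
      · exact h
      · exact h1.trans (hc.trans h2)
      · exact h1.trans (hc.symm.trans h2)
  · by_cases hd : (openGraph (↑X : BondConfig V)).Reachable u v
    · have hcz : ¬ (openGraph (↑(insert s(u, v) X) : BondConfig V)).Reachable s t := fun h => by
        rcases reach_insert_edge h with h | ⟨h1, h2⟩ | ⟨h1, h2⟩
        · exact hc h
        · exact hc (h1.trans (hd.trans h2))
        · exact hc (h1.trans (hd.symm.trans h2))
      exact Or.inr (Or.inr (Or.inr (Or.inl ⟨apConn_of_not_reachable hc, if_pos hd, apConn_of_not_reachable hcz,
        apConn_of_reachable (reach_mono_insert _ hd)⟩)))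
    · by_cases hcz : (openGraph (↑(insert s(u, v) X) : BondConfig V)).Reachable s t
      · -- the edge `uv` is pivotal: `s ↔ u, v ↔ t` (or crossed), hence `u ↔ v` through `st`
        have ha : (openGraph (↑(insert s(s, t) X) : BondConfig V)).Reachable u v := by
          rcases reach_insert_edge hcz with h | ⟨h1, h2⟩ | ⟨h1, h2⟩
          · exact absurd h hc
          · exact ((reach_mono_insert _ h1.symm).trans (reach_insert_self X hst)).trans (reach_mono_insert _ h2.symm)
          · exact ((reach_mono_insert _ h2).trans (reach_insert_self X hst).symm).trans (reach_mono_insert _ h1)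
        exact Or.inr (Or.inr (Or.inl ⟨apConn_of_not_reachable hc, if_neg hd, apConn_of_reachable hcz, apConn_of_reachable ha⟩))
      · have ha : ¬ (openGraph (↑(insert s(s, t) X) : BondConfig V)).Reachable u v := fun h => by
          rcases reach_insert_edge h with h | ⟨h1, h2⟩ | ⟨h1, h2⟩
          · exact hd h
          · exact hcz (((reach_mono_insert _ h1.symm).trans (reach_insert_self X huv)).trans (reach_mono_insert _ h2.symm))
          · exact hcz (((reach_mono_insert _ h2).trans (reach_insert_self X huv).symm).trans (reach_mono_insert _ h1))
        exact Or.inr (Or.inr (Or.inr (Or.inr ⟨apConn_of_not_reachable hc, if_neg hd, apConn_of_not_reachable hcz,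
          apConn_of_not_reachable ha⟩)))

/-- **The pointwise twin identity** (memo g14 §5.6): for two configurations `X` (a member) and `Y` (its partner),
`q^{d+c}(1-c̄^z) - q^{d̄+c̄}(1-c^z) = q²(c^z - c̄^z) + (1-q)[(q c^z + 1 - c^z)(1 - c̄^z) a - (q c̄^z + 1 - c̄^z)(1 - c^z) ā]`. [folklore] -/
theorem twin_pointwise (q : ℝ) (X Y : Finset (Sym2 V)) {s t u v : V} (hst : s ≠ t) (huv : u ≠ v) :
    q ^ ((if (openGraph (↑X : BondConfig V)).Reachable u v then 0 else 1) +
          (if (openGraph (↑X : BondConfig V)).Reachable s t then 1 else 0)) * (1 - apConn (insert s(u, v) Y) s t) -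
      q ^ ((if (openGraph (↑Y : BondConfig V)).Reachable u v then 0 else 1) +
          (if (openGraph (↑Y : BondConfig V)).Reachable s t then 1 else 0)) * (1 - apConn (insert s(u, v) X) s t) =
    q ^ 2 * (apConn (insert s(u, v) X) s t - apConn (insert s(u, v) Y) s t) +
      (1 - q) * ((q * apConn (insert s(u, v) X) s t + (1 - apConn (insert s(u, v) X) s t)) * (1 - apConn (insert s(u, v) Y) s t) *
          apConn (insert s(s, t) X) u v -
        (q * apConn (insert s(u, v) Y) s t + (1 - apConn (insert s(u, v) Y) s t)) * (1 - apConn (insert s(u, v) X) s t) *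
          apConn (insert s(s, t) Y) u v) := by
  have hX := twin_side_cases X hst huv
  have hY := twin_side_cases Y hst huv
  have eX : (if (openGraph (↑X : BondConfig V)).Reachable s t then (1 : ℕ) else 0) =
      (if apConn X s t = 1 then 1 else 0) := by
    by_cases hr : (openGraph (↑X : BondConfig V)).Reachable s t
    · rw [if_pos hr, apConn_of_reachable hr, if_pos rfl]
    · rw [if_neg hr, apConn_of_not_reachable hr, if_neg (by norm_num)]
  have eY : (if (openGraph (↑Y : BondConfig V)).Reachable s t then (1 : ℕ) else 0) =
      (if apConn Y s t = 1 then 1 else 0) := by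
    by_cases hr : (openGraph (↑Y : BondConfig V)).Reachable s t
    · rw [if_pos hr, apConn_of_reachable hr, if_pos rfl]
    · rw [if_neg hr, apConn_of_not_reachable hr, if_neg (by norm_num)]
  rw [eX, eY]
  simp only at hX hY
  rcases hX with ⟨c1, d1, z1, a1⟩ | ⟨c1, d1, z1, a1⟩ | ⟨c1, d1, z1, a1⟩ | ⟨c1, d1, z1, a1⟩ | ⟨c1, d1, z1, a1⟩ <;>
  rcases hY with ⟨c2, d2, z2, a2⟩ | ⟨c2, d2, z2, a2⟩ | ⟨c2, d2, z2, a2⟩ | ⟨c2, d2, z2, a2⟩ | ⟨c2, d2, z2, a2⟩ <;>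
  simp only [c1, d1, z1, a1, c2, d2, z2, a2] <;> norm_num <;> ring

/-! ### The identity -/

/-- **`q · U¹¹(y ∥ M) = q² · apUpcW + (1 - q) · apX2Dual`** (memo g14 §5.6; the dual of gen 12's `q·V = q·U + (1-q)·X2`): `z = uv ∈ M`, `y = st ∉ M`,
`T = M ∖ z`, `h` with sections `g` over `y` and over `z`. [cite: Grimmett2006, §1.4 eq. (1.20) (p. 15); §6.1 (pp. 133–136)] -/
theorem apUpcSplit_parallel_twin_eq (q : ℝ) {M : Finset (Sym2 V)} {s t u v : V} (hst : s ≠ t) (huv : u ≠ v)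
    (hzM : s(u, v) ∈ M) (hyM : s(s, t) ∉ M) {h g : Finset (Sym2 V) → ℝ}
    (hhy : ∀ A ⊆ M.erase s(u, v), h (insert s(s, t) A) = g A) (hhz : ∀ A ⊆ M.erase s(u, v), h (insert s(u, v) A) = g A) :
    q * apUpcSplit q (insert s(s, t) M) s t s(s, t) s(u, v) h =
      q ^ 2 * apUpcW q (M.erase s(u, v)) s t u v g + (1 - q) * apX2Dual q (M.erase s(u, v)) s t u v g := by
  set y : Sym2 V := s(s, t) with hy_def
  set z : Sym2 V := s(u, v) with hz_def
  set T := M.erase z with hT_def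
  have hyz : y ≠ z := fun hh => hyM (hh ▸ hzM)
  have hzT : z ∉ T := Finset.notMem_erase _ _
  have hyT : y ∉ T := fun hh => hyM (Finset.mem_of_mem_erase hh)
  have hMT : M = insert z T := (Finset.insert_erase hzM).symm
  have hyzT : y ∉ insert z T := by rw [← hMT]; exact hyM
  rw [hMT]
  set E := insert y (insert z T) with hE
  -- complements inside `E`
  have sdiff_y : ∀ A ⊆ T, E \ insert y A = insert z (T \ A) := by
    intro A hA; ext e
    simp only [hE, Finset.mem_sdiff, Finset.mem_insert, not_or]
    constructor
    · rintro ⟨h1 | h1 | h1, hne, hnA⟩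
      · exact absurd h1 hne
      · exact Or.inl h1
      · exact Or.inr ⟨h1, hnA⟩
    · rintro (h1 | ⟨h1, h2⟩)
      · exact ⟨Or.inr (Or.inl h1), fun hh => hyz (h1 ▸ hh).symm, fun hh => hzT (h1 ▸ hA hh)⟩
      · exact ⟨Or.inr (Or.inr h1), fun hh => hyT (hh ▸ h1), h2⟩
  have sdiff_z : ∀ A ⊆ T, E \ insert z A = insert y (T \ A) := by
    intro A hA; ext e
    simp only [hE, Finset.mem_sdiff, Finset.mem_insert, not_or]
    constructor
    · rintro ⟨h1 | h1 | h1, hne, hnA⟩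
      · exact Or.inl h1
      · exact absurd h1 hne
      · exact Or.inr ⟨h1, hnA⟩
    · rintro (h1 | ⟨h1, h2⟩)
      · exact ⟨Or.inl h1, fun hh => hyz (h1 ▸ hh), fun hh => hyT (h1 ▸ hA hh)⟩
      · exact ⟨Or.inr (Or.inr h1), fun hh => hzT (hh ▸ h1), h2⟩
  -- the split indicator on the four families
  have ind_A : ∀ A ⊆ T, splitInd y z A = 0 := fun A hA => by
    unfold splitInd; rw [if_neg]
    intro hh
    exact hzT (hA (not_not.1 fun hzA => hyT (hA (hh.2 hzA))))
  have ind_yA : ∀ A ⊆ T, splitInd y z (insert y A) = 1 := fun A hA => by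
    unfold splitInd; rw [if_pos]
    exact ⟨fun _ hh => (Finset.mem_insert.1 hh).elim (fun e => hyz e.symm) (fun e => hzT (hA e)), fun _ => Finset.mem_insert_self _ _⟩
  have ind_zA : ∀ A ⊆ T, splitInd y z (insert z A) = 1 := fun A hA => by
    unfold splitInd; rw [if_pos]
    constructor
    · intro hh; exact ((Finset.mem_insert.1 hh).elim hyz (fun e => hyT (hA e))).elim
    · intro hh; exact absurd (Finset.mem_insert_self z A) hh
  have ind_yzA : ∀ A ⊆ T, splitInd y z (insert y (insert z A)) = 0 := fun A hA => by
    unfold splitInd; rw [if_neg]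
    intro hh
    exact hh.1 (Finset.mem_insert_self _ _) (Finset.mem_insert_of_mem (Finset.mem_insert_self _ _))
  -- the `y`-edge joins the terminals; one-edge cluster counts
  have conn_y : ∀ A : Finset (Sym2 V), apConn (insert y A) s t = 1 := fun A => apConn_of_reachable (reach_insert_self A hst)
  have k_y : ∀ A : Finset (Sym2 V), clusterCount (↑(insert y A) : BondConfig V) ∅ + 1 =
      clusterCount (↑A : BondConfig V) ∅ + (if (openGraph (↑A : BondConfig V)).Reachable s t then 1 else 0) := by
    intro A
    have kk := clusterCount_union_pair_add (↑A : BondConfig V) s t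
    have e : (↑(insert y A) : BondConfig V) = ↑A ∪ {s(s, t)} := by rw [hy_def, Finset.coe_insert, Set.insert_eq, Set.union_comm]
    rw [e]; split_ifs at kk ⊢ <;> omega
  have k_z : ∀ A : Finset (Sym2 V), clusterCount (↑A : BondConfig V) ∅ =
      clusterCount (↑(insert z A) : BondConfig V) ∅ + (if (openGraph (↑A : BondConfig V)).Reachable u v then 0 else 1) := by
    intro A
    have kk := clusterCount_union_pair_add (↑A : BondConfig V) u v
    have e : (↑(insert z A) : BondConfig V) = ↑A ∪ {s(u, v)} := by rw [hz_def, Finset.coe_insert, Set.insert_eq, Set.union_comm]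
    rw [e]; omega
  -- expand the left-hand side into the four families
  unfold apUpcSplit
  rw [hE, Finset.sum_powerset_insert hyzT, Finset.sum_powerset_insert hzT, Finset.sum_powerset_insert hzT]
  have fam0 : ∑ A ∈ T.powerset, q ^ apExp E A * (splitInd y z A * ((apConn A s t - apConn (E \ A) s t) * h A)) = 0 :=
    Finset.sum_eq_zero fun A hA => by rw [ind_A A (Finset.mem_powerset.1 hA)]; ring
  have fam3 : ∑ A ∈ T.powerset, q ^ apExp E (insert y (insert z A)) *
      (splitInd y z (insert y (insert z A)) * ((apConn (insert y (insert z A)) s t - apConn (E \ insert y (insert z A)) s t) *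
        h (insert y (insert z A)))) = 0 :=
    Finset.sum_eq_zero fun A hA => by rw [ind_yzA A (Finset.mem_powerset.1 hA)]; ring
  -- the two split families, per configuration
  have famy : ∀ A ∈ T.powerset, q * (q ^ apExp E (insert y A) *
      (splitInd y z (insert y A) * ((apConn (insert y A) s t - apConn (E \ insert y A) s t) * h (insert y A)))) =
      q ^ (clusterCount (↑(insert z A) : BondConfig V) ∅ + clusterCount (↑(insert z (T \ A)) : BondConfig V) ∅) *
        (q ^ ((if (openGraph (↑A : BondConfig V)).Reachable u v then 0 else 1) +
            (if (openGraph (↑A : BondConfig V)).Reachable s t then 1 else 0)) * (1 - apConn (insert z (T \ A)) s t) * g A) := by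
    intro A hA
    have hAT := Finset.mem_powerset.1 hA
    rw [ind_yA A hAT, sdiff_y A hAT, conn_y, hhy A hAT]
    unfold apExp
    rw [sdiff_y A hAT]
    have e1 : q * q ^ (clusterCount (↑(insert y A) : BondConfig V) ∅ + clusterCount (↑(insert z (T \ A)) : BondConfig V) ∅) =
        q ^ (clusterCount (↑(insert z A) : BondConfig V) ∅ + clusterCount (↑(insert z (T \ A)) : BondConfig V) ∅) *
          q ^ ((if (openGraph (↑A : BondConfig V)).Reachable u v then 0 else 1) +
            (if (openGraph (↑A : BondConfig V)).Reachable s t then 1 else 0)) := by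
      rw [← pow_succ', ← pow_add]
      congr 1
      have := k_y A; have := k_z A; omega
    calc _ = (q * q ^ (clusterCount (↑(insert y A) : BondConfig V) ∅ + clusterCount (↑(insert z (T \ A)) : BondConfig V) ∅)) *
          ((1 - apConn (insert z (T \ A)) s t) * g A) := by ring
      _ = _ := by rw [e1]; ring
  have famz : ∀ A ∈ T.powerset, q * (q ^ apExp E (insert z A) *
      (splitInd y z (insert z A) * ((apConn (insert z A) s t - apConn (E \ insert z A) s t) * h (insert z A)))) =
      - (q ^ (clusterCount (↑(insert z A) : BondConfig V) ∅ + clusterCount (↑(insert z (T \ A)) : BondConfig V) ∅) *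
        (q ^ ((if (openGraph (↑(T \ A) : BondConfig V)).Reachable u v then 0 else 1) +
            (if (openGraph (↑(T \ A) : BondConfig V)).Reachable s t then 1 else 0)) * (1 - apConn (insert z A) s t) * g A)) := by
    intro A hA
    have hAT := Finset.mem_powerset.1 hA
    rw [ind_zA A hAT, sdiff_z A hAT, conn_y, hhz A hAT]
    unfold apExp
    rw [sdiff_z A hAT]
    have e1 : q * q ^ (clusterCount (↑(insert z A) : BondConfig V) ∅ + clusterCount (↑(insert y (T \ A)) : BondConfig V) ∅) =
        q ^ (clusterCount (↑(insert z A) : BondConfig V) ∅ + clusterCount (↑(insert z (T \ A)) : BondConfig V) ∅) *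
          q ^ ((if (openGraph (↑(T \ A) : BondConfig V)).Reachable u v then 0 else 1) +
            (if (openGraph (↑(T \ A) : BondConfig V)).Reachable s t then 1 else 0)) := by
      rw [← pow_succ', ← pow_add]
      congr 1
      have := k_y (T \ A); have := k_z (T \ A); omega
    calc _ = (q * q ^ (clusterCount (↑(insert z A) : BondConfig V) ∅ + clusterCount (↑(insert y (T \ A)) : BondConfig V) ∅)) *
          ((apConn (insert z A) s t - 1) * g A) := by ring
      _ = _ := by rw [e1]; ring
  rw [fam0, fam3, zero_add, add_zero, mul_add, Finset.mul_sum, Finset.mul_sum, Finset.sum_congr rfl famz,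
    Finset.sum_congr rfl famy]
  -- the right-hand side: flip the `g(T∖A)`-half of `apX2Dual`
  unfold apUpcW apX2Dual
  have hdual : ∑ A ∈ T.powerset,
      q ^ (clusterCount (↑(insert z A) : BondConfig V) ∅ + clusterCount (↑(insert z (T \ A)) : BondConfig V) ∅) *
        (q * apConn (insert z (T \ A)) s t + (1 - apConn (insert z (T \ A)) s t)) *
        ((1 - apConn (insert z A) s t) * apConn (insert s(s, t) (T \ A)) u v * (g (T \ A) - g A)) =
      ∑ A ∈ T.powerset, q ^ (clusterCount (↑(insert z A) : BondConfig V) ∅ + clusterCount (↑(insert z (T \ A)) : BondConfig V) ∅) *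
        ((q * apConn (insert z A) s t + (1 - apConn (insert z A) s t)) * (1 - apConn (insert z (T \ A)) s t) *
            apConn (insert s(s, t) A) u v -
          (q * apConn (insert z (T \ A)) s t + (1 - apConn (insert z (T \ A)) s t)) * (1 - apConn (insert z A) s t) *
            apConn (insert s(s, t) (T \ A)) u v) * g A := by
    have split : ∀ A ∈ T.powerset,
        q ^ (clusterCount (↑(insert z A) : BondConfig V) ∅ + clusterCount (↑(insert z (T \ A)) : BondConfig V) ∅) *
          (q * apConn (insert z (T \ A)) s t + (1 - apConn (insert z (T \ A)) s t)) *
          ((1 - apConn (insert z A) s t) * apConn (insert s(s, t) (T \ A)) u v * (g (T \ A) - g A)) =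
        q ^ (clusterCount (↑(insert z A) : BondConfig V) ∅ + clusterCount (↑(insert z (T \ A)) : BondConfig V) ∅) *
          (q * apConn (insert z (T \ A)) s t + (1 - apConn (insert z (T \ A)) s t)) *
          ((1 - apConn (insert z A) s t) * apConn (insert s(s, t) (T \ A)) u v) * g (T \ A) -
        q ^ (clusterCount (↑(insert z A) : BondConfig V) ∅ + clusterCount (↑(insert z (T \ A)) : BondConfig V) ∅) *
          (q * apConn (insert z (T \ A)) s t + (1 - apConn (insert z (T \ A)) s t)) *
          ((1 - apConn (insert z A) s t) * apConn (insert s(s, t) (T \ A)) u v) * g A := fun A _ => by ring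
    rw [Finset.sum_congr rfl split, Finset.sum_sub_distrib]
    rw [sum_powerset_flip T (fun A => q ^ (clusterCount (↑(insert z A) : BondConfig V) ∅ +
        clusterCount (↑(insert z (T \ A)) : BondConfig V) ∅) *
        (q * apConn (insert z (T \ A)) s t + (1 - apConn (insert z (T \ A)) s t)) *
        ((1 - apConn (insert z A) s t) * apConn (insert s(s, t) (T \ A)) u v) * g (T \ A))]
    rw [← Finset.sum_sub_distrib]
    refine Finset.sum_congr rfl fun A hA => ?_
    rw [Finset.sdiff_sdiff_eq_self (Finset.mem_powerset.1 hA), Nat.add_comm (clusterCount (↑(insert z (T \ A)) : BondConfig V) ∅)]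
    ring
  rw [hdual, Finset.mul_sum, Finset.mul_sum, ← Finset.sum_add_distrib, ← Finset.sum_add_distrib]
  refine Finset.sum_congr rfl fun A _ => ?_
  have key := twin_pointwise q A (T \ A) hst huv
  calc _ = q ^ (clusterCount (↑(insert s(u, v) A) : BondConfig V) ∅ + clusterCount (↑(insert s(u, v) (T \ A)) : BondConfig V) ∅) *
        g A * (q ^ ((if (openGraph (↑A : BondConfig V)).Reachable u v then 0 else 1) +
            (if (openGraph (↑A : BondConfig V)).Reachable s t then 1 else 0)) * (1 - apConn (insert s(u, v) (T \ A)) s t) -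
          q ^ ((if (openGraph (↑(T \ A) : BondConfig V)).Reachable u v then 0 else 1) +
            (if (openGraph (↑(T \ A) : BondConfig V)).Reachable s t then 1 else 0)) * (1 - apConn (insert s(u, v) A) s t)) := by ring
    _ = _ := by rw [key]; ring

/-- **THEOREM (the parallel twin, `0 < q ≤ 1`): `U¹¹(y ∥ M) ≥ 0`.**  For `M` two-terminal series–parallel between `s, t` with a marked edge
`z = uv ∈ M`, `y = st ∉ M`, and `h` monotone on the sub-configurations of `M ∪ {y}` not reading `y, z`:
`0 ≤ apUpcSplit q (insert st M) s t st uv h`.  [cite: Grimmett2006, §3.8 (pp. 61–62); §3.9 (p. 63); §6.1 (pp. 133–136)] -/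
theorem apUpcSplit_parallel_twin_nonneg {q : ℝ} (hq0 : 0 < q) (hq1 : q ≤ 1) {M : Finset (Sym2 V)} {s t u v : V} (hM : IsTTSP M s t)
    (huv : s(u, v) ∈ M) (hy : s(s, t) ∉ M) {h : Finset (Sym2 V) → ℝ}
    (hmono : ∀ ⦃A B : Finset (Sym2 V)⦄, A ⊆ B → B ⊆ insert s(s, t) M → h A ≤ h B)
    (hhy : ∀ A, h (insert s(s, t) A) = h A) (hhz : ∀ A, h (insert s(u, v) A) = h A) :
    0 ≤ apUpcSplit q (insert s(s, t) M) s t s(s, t) s(u, v) h := by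
  have hne : u ≠ v := fun hh => hM.not_isDiag huv (Sym2.mk_isDiag_iff.2 hh)
  have hT : M.erase s(u, v) ⊆ M.erase s(u, v) := subset_rfl
  have hmono' : ∀ ⦃A B : Finset (Sym2 V)⦄, A ⊆ B → B ⊆ M.erase s(u, v) → h A ≤ h B :=
    fun A B hAB hB => hmono hAB (hB.trans ((Finset.erase_subset _ _).trans (Finset.subset_insert _ _)))
  have key := apUpcSplit_parallel_twin_eq q hM.ne hne huv hy (g := h) (fun A _ => hhy A) (fun A _ => hhz A)
  have hW := apUpcW_nonneg_of_isTTSP hq0 hM huv hT hmono'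
  have hX := apX2Dual_nonneg_of_isTTSP hq0 hM huv hT hmono'
  have hsum : 0 ≤ q * apUpcSplit q (insert s(s, t) M) s t s(s, t) s(u, v) h := by
    rw [key]
    exact add_nonneg (mul_nonneg (pow_nonneg hq0.le 2) hW) (mul_nonneg (sub_nonneg.2 hq1) hX)
  exact (mul_nonneg_iff_of_pos_left hq0).1 hsum

/-- **`U¹¹ ≥ 0` for every network grown from a parallel core `y ∥ M`** (`0 < q ≤ 1`): with `M`, `z = uv ∈ M`, `y = st ∉ M` as in
`apUpcSplit_parallel_twin_nonneg` and `(E; s', t')` any network obtained from `(M ∪ {y}; s, t)` by gluing two-terminal series–parallel parts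
(`FK.IsSpine`, file `…SplitClosure`): `0 ≤ apUpcSplit q E s' t' y z h` for `h` monotone on the subsets of `E` and not reading `y, z`.  Together
with `FK.apUpcSplit_nonneg_of_pendant_core` this is Conjecture U¹¹ of memo g11 whenever the lowest decomposition node containing both marked
edges has a single-edge child. [cite: Grimmett2006, §3.9 (p. 63)] -/
theorem apUpcSplit_nonneg_of_parallel_core {q : ℝ} (hq0 : 0 < q) (hq1 : q ≤ 1) {M E : Finset (Sym2 V)} {s t u v s' t' : V}
    (hM : IsTTSP M s t) (huv : s(u, v) ∈ M) (hy : s(s, t) ∉ M) {ps : List (SpinePart V)}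
    (hsp : IsSpine ps (insert s(s, t) M) s t E s' t') {h : Finset (Sym2 V) → ℝ}
    (hmono : ∀ ⦃A B : Finset (Sym2 V)⦄, A ⊆ B → B ⊆ E → h A ≤ h B)
    (hhy : ∀ A, h (insert s(s, t) A) = h A) (hhz : ∀ A, h (insert s(u, v) A) = h A) :
    0 ≤ apUpcSplit q E s' t' s(s, t) s(u, v) h := by
  refine hsp.apUpcSplit_nonneg hq0 hM.ne (Finset.mem_insert_self _ _) (Finset.mem_insert_of_mem huv) ?_ h hmono hhy hhz
  intro h' hmono' hhy' hhz'
  exact apUpcSplit_parallel_twin_nonneg hq0 hq1 hM huv hy hmono' hhy' hhz'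

end Identity

end FK

end Summit.CriticalPhenomena.PercolationContinuityZ3.Theorems

end
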